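import Literature.Analysis.FluidPDE.NSSereginBlowupCore
import Literature.Analysis.FluidPDE.LerayHopfSpatialGradient
import Literature.Analysis.FluidPDE.KNSSTypeIIHolds
import Literature.Analysis.FluidPDE.NSCriticalClosureBesovKatoClass
import Summits.NavierStokesRegularity.NavierStokesRegularity.Theorems.CertifiedBlowupCertifiedBlowupAxisymBlowupSwirlPersists
import HarnessLib

/-!
# Witnesses of the crux `CertifiedBlowupAxisymBlowup`: no extinction at the blow-up time

Theorems file landed `--supports stmt-NavierStokesRegularity-0727`, line `compact-amplification`
(continuation lead c3, wave 2; registered stub `not_tendsto_zero_of_isMaximalSmoothSolution`).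
The crux asks for a viscosity `ν > 0`, a time `T > 0` and a maximal smooth solution `(u, p)` of
lifespan `T`, Leray–Hopf on `[0, T]` from its rapidly decaying axisymmetric datum `u 0`. This file
proves, for an ARBITRARY such witness `(ν, T, u, p)` and using only PROVED theorems of the tree:

* `exists_rieszPressure_suitable_fullSlab_of_isKatoSolutionOn`: the Riesz pressure of a Kato
  `C_t L³` solution with essentially bounded datum, **up to the final time and for every
  viscosity `ν > 0`** (the tree's `IsKatoSolutionOn.exists_finalTime_rieszPressure`, stated there at
  unit viscosity): `u ∈ L³((0,T) × ℝ³)`, `P ∈ L^{3/2}((0,T) × ℝ³)` and `(u, P)` is a suitable weak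
  solution on the whole open slab `(0, T) × ℝ³` (suitability on the sub-slabs, glued along an
  exhaustion);
* `exists_isLocalLeraySolutionOn_of_lerayHopf_classical`: **a classical Leray–Hopf solution on
  `[0, T)` from a rapidly decaying datum is a local Leray solution on the FULL slab `(0, T) × ℝ³`**
  (Lemarié-Rieusset 2016, Def. 14.1) for its Riesz pressure: suitability and the pressure class from
  the previous item (the solution is a Kato solution, `isKatoSolutionOn_of_classical`), the uniformly
  local energy and gradient bounds up to `T` from the Leray–Hopf energy inequality
  (`IsLerayHopfOn.energy_bound`, `IsLerayHopfOn.exists_hasWeakSpatialGradientOn`), the datum from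
  the local Leray structure on `(0, T/2)` (`kato_isLocalLeraySolutionOn_holds`), the decay at spatial
  infinity from `u ∈ L³` of the strip;
* `eq_zero_of_tendsto_zero_of_lerayHopf_classical`: **backward uniqueness** — if such a solution
  tends to `0` in the sense of distributions as `t ↑ T`, then `u ≡ 0` on `(0, T) × ℝ³`
  (Lemarié-Rieusset 2016, Thm. 15.4, after Escauriaza–Seregin–Šverák 2003, the tree's discharged
  `lemarieRieusset_backward_uniqueness_slab_holds`; a.e. vanishing upgraded by continuity);
* `not_tendsto_zero_of_isMaximalSmoothSolution` (registered): **blow-up cannot coincide with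
  extinction** — no witness of the crux tends to `0` in `𝒟'(ℝ³)` as `t ↑ T` (a vanishing solution is
  bounded on `[0, T) × ℝ³`, and bounded Leray–Hopf classical solutions continue past `T`,
  `hasSmoothExtensionPast_of_bounded_holds`, contradicting maximality).

No new definitions, no named-fact hypotheses, no `sorry`.

## References

* P. G. Lemarié-Rieusset, *The Navier–Stokes Problem in the 21st Century*, CRC Press 2016,
  Def. 14.1 (p. 498), Thm. 15.1 (A) (p. 565), Thm. 15.4 (p. 568). [LemarieRieusset2016]
* L. Escauriaza, G. Seregin, V. Šverák, *`L_{3,∞}`-solutions of Navier–Stokes equations and backward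
  uniqueness*, Russ. Math. Surveys 58 (2003), 211–250, Thm. 1.4, §5. [EscauriazaSereginSverak2003]
* W. Rusin, V. Šverák, J. Funct. Anal. 260 (2011), §4 (the Riesz pressure up to the blow-up time).
  [RusinSverak2011]
* J. C. Robinson, J. L. Rodrigo, W. Sadowski, *The Three-Dimensional Navier–Stokes Equations*,
  CUP 2016, Thm. 8.17 (bounded solutions continue). [RobinsonRodrigoSadowski2016]
-/

-- the summit and its single problem share the name (D-0017 nested layout)
set_option linter.dupNamespace false

noncomputable section

open MeasureTheory Set Function Filter Topology Metric
open scoped ENNReal NNReal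

namespace Summit.NavierStokesRegularity.NavierStokesRegularity.Theorems.CertifiedBlowupAxisymBlowup.CompactAmplification

open Literature.Analysis.FluidPDE

section Witness

variable {ν T : ℝ} {u : ℝ → (EuclideanSpace ℝ (Fin 3)) → (EuclideanSpace ℝ (Fin 3))}
  {p : ℝ → (EuclideanSpace ℝ (Fin 3)) → ℝ}

/-! ### The Riesz pressure of a Kato solution up to the final time, any viscosity -/

/-- **The Riesz pressure of a Kato solution with essentially bounded datum, up to the final time,
viscosity `ν > 0`** (Rusin–Šverák 2011, §4; Lemarié-Rieusset 2016, Prop. 6.5 / Def. 6.9 and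
Thm. 15.1 (A); the tree's `IsKatoSolutionOn.exists_finalTime_rieszPressure` verbatim with `1 ↦ ν`).
For a Kato solution `u` on `[0, T)`, `T > 0`, with `|a| ≤ M₀` a.e.: `u ∈ L³((0,T) × ℝ³)`
(`lintegral_enorm_cube_lt_top_of_ae_bounded`), the glued Riesz pressure `P`
(`exists_measurable_rieszPressure`) lies in `L^{3/2}((0,T) × ℝ³)` (`lintegral_rieszPressure_le`),
and `(u, P)` is a suitable weak solution on every sub-slab `(0, S')`, `S' < T`
(`distributional_slab_of_pressure`, `suitable_slab_of_pressure`), hence on the whole open slab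
`(0, T) × ℝ³` (`IsSuitableWeakSolutionOn.of_exhaustion` along `(0, T(n+1)/(n+2))`). No assumption
is made on `u` at `t = T`. [cite: LemarieRieusset2016, Thm. 15.1 (A) (p. 565) with Prop. 6.5] -/
theorem exists_rieszPressure_suitable_fullSlab_of_isKatoSolutionOn (hν : 0 < ν) (hT : 0 < T)
    {a : EuclideanSpace ℝ (Fin 3) → EuclideanSpace ℝ (Fin 3)} (hu : IsKatoSolutionOn T ν a u)
    {M₀ : ℝ} (hbd : ∀ᵐ x ∂(volume : Measure (EuclideanSpace ℝ (Fin 3))), ‖a x‖ ≤ M₀) :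
    ∃ P : ℝ → EuclideanSpace ℝ (Fin 3) → ℝ,
      (∫⁻ z in Ioo 0 T ×ˢ (univ : Set (EuclideanSpace ℝ (Fin 3))), ‖u z.1 z.2‖ₑ ^ (3 : ℝ) < ∞) ∧
      (∫⁻ z in Ioo 0 T ×ˢ (univ : Set (EuclideanSpace ℝ (Fin 3))),
        ‖P z.1 z.2‖ₑ ^ (3 / 2 : ℝ) < ∞) ∧
      IsSuitableWeakSolutionOn (slab (EuclideanSpace ℝ (Fin 3)) (Ioo 0 T) isOpen_Ioo) ν 0 u P := by
  have hL3 := hu.lintegral_enorm_cube_lt_top_of_ae_bounded hν hT hbd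
  obtain ⟨P, hPm, hP⟩ := hu.exists_measurable_rieszPressure hν hT
  have hP32 : ∫⁻ z in Ioo 0 T ×ˢ (univ : Set (EuclideanSpace ℝ (Fin 3))),
      ‖P z.1 z.2‖ₑ ^ (3 / 2 : ℝ) < ∞ := by
    refine (lintegral_rieszPressure_le hu hPm (hP.mono fun t ht => ht.2) le_rfl).trans_lt ?_
    exact ENNReal.mul_lt_top (ENNReal.rpow_lt_top_of_nonneg (by norm_num) ENNReal.coe_ne_top) hL3
  -- suitability on every sub-slab `(0, S')`, `0 < S' < T`
  have hsub : ∀ S' ∈ Ioo 0 T, IsSuitableWeakSolutionOn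
      (slab (EuclideanSpace ℝ (Fin 3)) (Ioo 0 S') isOpen_Ioo) ν 0 u P := by
    intro S' hS'
    have hmono : Ioo 0 S' ×ˢ (univ : Set (EuclideanSpace ℝ (Fin 3))) ⊆ Ioo 0 T ×ˢ univ :=
      prod_mono (Ioo_subset_Ioo_right hS'.2.le) Subset.rfl
    have hP32' : ∫⁻ z in Ioo 0 S' ×ˢ (univ : Set (EuclideanSpace ℝ (Fin 3))),
        ‖P z.1 z.2‖ₑ ^ (3 / 2 : ℝ) < ∞ := (lintegral_mono_set hmono).trans_lt hP32
    have hPm' : AEStronglyMeasurable (uncurry P)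
        (volume.restrict (Ioo 0 S' ×ˢ (univ : Set (EuclideanSpace ℝ (Fin 3))))) :=
      hPm.mono_measure (Measure.restrict_mono hmono le_rfl)
    have hp32 : MemLp (uncurry P) (3 / 2 : ℝ≥0∞)
        (volume.restrict (Ioo 0 S' ×ˢ (univ : Set (EuclideanSpace ℝ (Fin 3))))) :=
      memLp_threeHalves_of_lintegral_rpow_lt_top hPm' hP32'
    have hNS := hu.distributional_slab_of_pressure hν hS'.2 hp32 (by
      filter_upwards [ae_restrict_of_ae_restrict_of_subset (Ioo_subset_Ioo_right hS'.2.le) hP,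
        ae_restrict_mem measurableSet_Ioo] with t ht htI φ hφ hφc
      refine (integral_congr_ae ?_).trans
        (integral_rieszPressure_mul_laplacian (hu.memLp ⟨htI.1.le, htI.2.trans hS'.2⟩) hφ hφc)
      filter_upwards [ht.1] with x hx
      rw [hx])
    exact hu.suitable_slab_of_pressure hν hS'.1 hS'.2 hNS hP32'
  refine ⟨P, hL3, hP32, ?_⟩
  -- exhaustion of the open slab by the sub-slabs `(0, T(n+1)/(n+2))`
  set Sn : ℕ → ℝ := fun n => T * (((n : ℝ) + 1) / ((n : ℝ) + 2)) with hSn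
  have hSn0 : ∀ n, 0 < Sn n := fun n => by positivity
  have hSnS : ∀ n, Sn n < T := fun n => by
    rw [hSn]; dsimp only
    have : ((n : ℝ) + 1) / ((n : ℝ) + 2) < 1 := by rw [div_lt_one (by positivity)]; linarith
    nlinarith
  have hSmono : Monotone Sn := by
    intro m n hmn
    rw [hSn]; dsimp only
    refine mul_le_mul_of_nonneg_left ?_ hT.le
    have hm : (m : ℝ) ≤ n := by exact_mod_cast hmn
    rw [div_le_div_iff₀ (by positivity) (by positivity)]
    nlinarith
  exact IsSuitableWeakSolutionOn.of_exhaustion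
    (Qn := fun n => slab (EuclideanSpace ℝ (Fin 3)) (Ioo 0 (Sn n)) isOpen_Ioo)
    (fun n => slab_mono (Ioo_subset_Ioo_right (hSnS n).le))
    (fun m n hmn => slab_mono (Ioo_subset_Ioo_right (hSmono hmn)))
    (fun K hK hKc => exists_subslab_of_isCompact hK hKc)
    (fun n => hsub (Sn n) ⟨hSn0 n, hSnS n⟩)

/-! ### The witness is a local Leray solution on the full slab `(0, T) × ℝ³` -/

/-- **A classical Leray–Hopf solution on `[0, T)` from a rapidly decaying datum is a local Leray
solution on the full slab `(0, T) × ℝ³`** (Lemarié-Rieusset 2016, Def. 14.1, for the Riesz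
pressure; the pattern of the proof of Thm. 15.1 (A), p. 565, carried up to the final time). The
solution is a Kato `C_t L³` solution on `[0, T)` (`isKatoSolutionOn_of_classical`) with bounded
datum, so `exists_rieszPressure_suitable_fullSlab_of_isKatoSolutionOn` supplies suitability on the
open slab, `u ∈ L³` and `P ∈ L^{3/2}` of the strip; `u ∈ L²((0,T) × K)` is a clause of the weak
formulation; the uniformly local energy bound is the Leray–Hopf bound `u ∈ L^∞(0,T; L²)`; the
weak spatial gradient on the slab with `∫₀ᵀ∫ |∇u|² < ∞` is
`IsLerayHopfOn.exists_hasWeakSpatialGradientOn`; the datum is attained in `L²_loc` by the local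
Leray structure on `(0, T/2)` (`kato_isLocalLeraySolutionOn_holds`); the decay at spatial infinity
follows from `u ∈ L³((0,T) × ℝ³)` (`tendsto_lintegral_slab_ball_sq_cocompact_of_cube`).
[cite: LemarieRieusset2016, Def. 14.1 (p. 498) and Thm. 15.1 (A) (p. 565)] -/
theorem exists_isLocalLeraySolutionOn_of_lerayHopf_classical (hν : 0 < ν) (hT : 0 < T)
    (hcl : IsClassicalNSSolutionOn (Ico 0 T) ν 0 u p) (hLH : IsLerayHopfOn T ν 0 (u 0) u)
    (hdec : HasRapidSpatialDecay (u 0)) :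
    ∃ π : ℝ → EuclideanSpace ℝ (Fin 3) → ℝ, IsLocalLeraySolutionOn T ν (u 0) u π := by
  have hK : IsKatoSolutionOn T ν (u 0) u := isKatoSolutionOn_of_classical hν hT hcl hLH hdec
  -- the datum is bounded
  obtain ⟨C₀, hC₀⟩ := hdec 0 0
  have hbd : ∀ᵐ x ∂(volume : Measure (EuclideanSpace ℝ (Fin 3))), ‖u 0 x‖ ≤ C₀ :=
    ae_of_all _ fun x => by
      have h1 := hC₀ x
      rwa [pow_zero, one_mul, norm_iteratedFDeriv_zero] at h1
  obtain ⟨P, hL3, hP32, hsuit⟩ :=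
    exists_rieszPressure_suitable_fullSlab_of_isKatoSolutionOn hν hT hK hbd
  -- the local Leray structure on `(0, T/2)`, for the attainment of the datum
  obtain ⟨p', hp'⟩ := kato_isLocalLeraySolutionOn_holds ν T (u 0) u hν hK (T / 2) (half_pos hT)
    (half_lt_self hT)
  -- the Leray–Hopf energy bound and the space–time weak gradient
  obtain ⟨CE, hCE⟩ := hLH.energy_bound
  obtain ⟨G, hGw, -, hGint, -⟩ := hLH.exists_hasWeakSpatialGradientOn
  refine ⟨P,
    { suitable := hsuit
      sqIntegrable := fun K hK' => hLH.weak.2.1 K hK'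
      pressure := fun K _ => lt_of_le_of_lt (lintegral_mono_set (prod_mono Subset.rfl
        (subset_univ _))) hP32
      uniformLocalEnergy := fun R _ =>
        ⟨CE, hCE.mono fun t ht x₀ => (setLIntegral_le_lintegral _ _).trans ht⟩
      uniformLocalGradient := ⟨G, hGw, fun R _ =>
        ⟨(∫⁻ z in Ioo 0 T ×ˢ (univ : Set (EuclideanSpace ℝ (Fin 3))),
          ENNReal.ofReal (frobeniusNormSq (G z.1 z.2))).toNNReal, fun x₀ => ?_⟩⟩
      initial := hp'.initial
      decay := fun R _ =>
        tendsto_lintegral_slab_ball_sq_cocompact_of_cube hK.aestronglyMeasurable hL3 R }⟩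
  rw [ENNReal.coe_toNNReal hGint.ne]
  exact lintegral_mono_set (prod_mono Subset.rfl (subset_univ _))

/-! ### Backward uniqueness: a solution tending to `0` at the final time vanishes identically -/

/-- **Backward uniqueness for the crux's class** (Lemarié-Rieusset 2016, Thm. 15.4, after
Escauriaza–Seregin–Šverák 2003: the tree's discharged `lemarieRieusset_backward_uniqueness_slab_holds`).
If a classical Leray–Hopf solution on `[0, T)` from a rapidly decaying datum tends to `0` in the
sense of distributions as `t ↑ T` (`∫⟪u(t), φ⟫ → 0` for every test field `φ`), then `u ≡ 0` on
`(0, T) × ℝ³`: it is a local Leray solution on the full slab with `L³`, weakly divergence-free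
datum, so `u = 0` a.e. on the strip by Thm. 15.4, and everywhere on the open strip by continuity
(`Measure.eqOn_open_of_ae_eq`). [cite: LemarieRieusset2016, Thm. 15.4 p. 568] -/
theorem eq_zero_of_tendsto_zero_of_lerayHopf_classical (hν : 0 < ν) (hT : 0 < T)
    (hcl : IsClassicalNSSolutionOn (Ico 0 T) ν 0 u p) (hLH : IsLerayHopfOn T ν 0 (u 0) u)
    (hdec : HasRapidSpatialDecay (u 0))
    (hlim : ∀ φ : EuclideanSpace ℝ (Fin 3) → EuclideanSpace ℝ (Fin 3),
      Literature.Analysis.FunctionSpaces.IsTestFunctionOn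
          (⊤ : TopologicalSpace.Opens (EuclideanSpace ℝ (Fin 3))) φ →
        Tendsto (fun t => ∫ x, inner ℝ (u t x) (φ x)) (𝓝[<] T) (𝓝 0)) :
    ∀ t ∈ Ioo 0 T, ∀ x, u t x = 0 := by
  have hK : IsKatoSolutionOn T ν (u 0) u := isKatoSolutionOn_of_classical hν hT hcl hLH hdec
  obtain ⟨π, hπ⟩ := exists_isLocalLeraySolutionOn_of_lerayHopf_classical hν hT hcl hLH hdec
  have hae := lemarieRieusset_backward_uniqueness_slab_holds hν hT (hK.memLp_initial hT)
    (hK.isWeaklyDivFree_initial hT) hπ hlim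
  -- continuity upgrades a.e. vanishing to vanishing on the open strip
  have hae' : uncurry u =ᵐ[volume.restrict (Ioo 0 T ×ˢ (univ : Set (EuclideanSpace ℝ (Fin 3))))]
      fun _ => (0 : EuclideanSpace ℝ (Fin 3)) := hae.mono fun z hz => hz
  have hcont : ContinuousOn (uncurry u) (Ioo 0 T ×ˢ (univ : Set (EuclideanSpace ℝ (Fin 3)))) :=
    hcl.smooth_velocity.continuousOn.mono (prod_mono Ioo_subset_Ico_self Subset.rfl)
  have hEq : EqOn (uncurry u) (fun _ => (0 : EuclideanSpace ℝ (Fin 3)))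
      (Ioo 0 T ×ˢ (univ : Set (EuclideanSpace ℝ (Fin 3)))) :=
    Measure.eqOn_open_of_ae_eq hae' (isOpen_Ioo.prod isOpen_univ) hcont continuousOn_const
  intro t ht x
  exact hEq (show (t, x) ∈ Ioo 0 T ×ˢ (univ : Set (EuclideanSpace ℝ (Fin 3))) from ⟨ht, mem_univ x⟩)

end Witness

/-- **No extinction at the blow-up time** (registered stub of stmt-NavierStokesRegularity-0727;
Lemarié-Rieusset 2016, Thm. 15.4 = backward uniqueness for local Leray solutions, after
Escauriaza–Seregin–Šverák 2003, Thm. 1.4 / §5): for every witness `(ν, T, u, p)` of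
`CertifiedBlowupAxisymBlowup` — a maximal Leray–Hopf classical solution of finite lifespan `T > 0`,
viscosity `ν > 0`, from a rapidly decaying axisymmetric datum — `u(t)` does NOT tend to `0` in
`𝒟'(ℝ³)` as `t ↑ T`: otherwise `u ≡ 0` on `(0, T) × ℝ³`
(`eq_zero_of_tendsto_zero_of_lerayHopf_classical`), so `u` is bounded on `[0, T) × ℝ³` (the datum
by its decay constant), and bounded Leray–Hopf classical solutions continue past `T`
(`hasSmoothExtensionPast_of_bounded_holds`), contradicting maximality. Blow-up cannot coincide with
extinction. [cite: LemarieRieusset2016, Thm. 15.4 p. 568] -/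
theorem not_tendsto_zero_of_isMaximalSmoothSolution : ∀ {ν T : ℝ} {u : ℝ → EuclideanSpace ℝ (Fin 3) → EuclideanSpace ℝ (Fin 3)} {p : ℝ → EuclideanSpace ℝ (Fin 3) → ℝ}, 0 < ν → 0 < T → IsMaximalSmoothSolution ν 0 u p T → IsLerayHopfOn T ν 0 (u 0) u → HasRapidSpatialDecay (u 0) → IsAxisymmetric (u 0) → ¬ ∀ φ : EuclideanSpace ℝ (Fin 3) → EuclideanSpace ℝ (Fin 3), Literature.Analysis.FunctionSpaces.IsTestFunctionOn (⊤ : TopologicalSpace.Opens (EuclideanSpace ℝ (Fin 3))) φ → Filter.Tendsto (fun t => ∫ x, inner ℝ (u t x) (φ x)) (nhdsWithin T (Set.Iio T)) (nhds 0) := by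
  intro ν T u p hν hT hmax hLH hdec _haxi hlim
  have hzero := eq_zero_of_tendsto_zero_of_lerayHopf_classical hν hT hmax.1 hLH hdec hlim
  -- the datum is bounded by its decay constant, the later slices vanish
  obtain ⟨C₀, hC₀⟩ := hdec 0 0
  have hC₀' : ∀ x, ‖u 0 x‖ ≤ C₀ := fun x => by
    have h1 := hC₀ x
    rwa [pow_zero, one_mul, norm_iteratedFDeriv_zero] at h1
  refine hmax.2 (hasSmoothExtensionPast_of_bounded_holds hν hT hmax.1 hLH ⟨C₀, fun t ht x => ?_⟩)
  rcases ht.1.eq_or_lt with h0 | hpos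
  · rw [← h0]
    exact hC₀' x
  · rw [hzero t ⟨hpos, ht.2⟩ x, norm_zero]
    exact (norm_nonneg _).trans (hC₀' 0)

end Summit.NavierStokesRegularity.NavierStokesRegularity.Theorems.CertifiedBlowupAxisymBlowup.CompactAmplification

end
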